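import Literature.Analysis.UnboundedOperators.SemigroupDuhamel
import HarnessLib

/-!
# The abstract Cauchy problem: classical solutions of `u′ = Au + g` are given by the variation of
  constants formula `u(t) = T(t)u(0) + ∫₀ᵗ T(t − s)g(s) ds`; uniqueness for `u′ = Au`

Analysis/UnboundedOperators proofs-layer file (theorems only, no definitions, no named facts),
continuing `SemigroupDuhamel.lean`, for the tree's `C0Semigroup 𝕜 E` on a Banach space with a
compatible real structure. Engel–Nagel (2000), Ch. II Prop. 6.2 / Thm. 6.7 (well-posedness of the
homogeneous abstract Cauchy problem: for `x ∈ D(A)` the orbit `T(·)x` is the UNIQUE classical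
solution) and Ch. VI Cor. 7.8 / Pazy (1983) §4.2 (an `E`-valued classical solution of the
inhomogeneous problem `u′(s) = Au(s) + g(s)` on `(0, t)`, continuous on `[0, t]`, satisfies the
variation of constants formula):

* `continuousOn_app_sub_apply` — `s ↦ T(t − s)w(s)` is continuous on `[0, t]` when `w` is;
* **`eq_app_add_integral_of_hasDerivAt`** — classical ⇒ mild:
  `u(t) = T(t)u(0) + ∫₀ᵗ T(t − s)g(s) ds` (the product rule `hasDerivWithinAt_app_sub_apply` gives
  `d/ds T(t − s)u(s) = T(t − s)g(s)` on `(0, t)`; fundamental theorem of calculus);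
* **`eq_app_of_hasDerivAt`** — UNIQUENESS for `u′ = Au`: a classical solution is `u(t) = T(t)u(0)`
  (existence for `u(0) ∈ D(A)` is the tree's `hasDerivAt_app_of_mem`).

So for every linear evolution equation whose operator comes with a C₀-semigroup in the tree (heat /
similarity-variable semigroups, the Hille–Yosida semigroups of `HilleYosida*.lean`), classical
solutions are unique and are represented by Duhamel's formula — the form in which linearised
stability / instability arguments (Jia–Šverák, the sheet-ℝ renewal route) consume the semigroup.

## References

* K.-J. Engel, R. Nagel, *One-Parameter Semigroups for Linear Evolution Equations* (2000),
  Ch. II Prop. 6.2, Thm. 6.7; Ch. VI §7 (inhomogeneous Cauchy problems), Cor. 7.8. [EngelNagel2000]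
* A. Pazy, *Semigroups of Linear Operators and Applications to PDE* (1983), Thm. 4.1.3, §4.2 (2.3).
-/

noncomputable section

open MeasureTheory Set Filter Topology
open scoped NNReal

namespace Literature.Analysis.UnboundedOperators

namespace C0Semigroup

variable {𝕜 E : Type*} [RCLike 𝕜] [NormedAddCommGroup E] [NormedSpace 𝕜 E]

/-- `s ↦ T(t − s)w(s)` is continuous on `[0, t]` (indeed on any set) when `w` is continuous there
(joint continuity with bounded times). [cite: EngelNagel2000, Ch. I Prop. 5.5] -/
theorem continuousOn_app_sub_apply [CompleteSpace E] (T : C0Semigroup 𝕜 E) (t : ℝ) {w : ℝ → E} {U : Set ℝ}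
    (hw : ContinuousOn w U) : ContinuousOn (fun s : ℝ => T.app (t - s).toNNReal (w s)) U := by
  intro s₀ hs₀
  have hτ : Tendsto (fun s : ℝ => (t - s).toNNReal) (𝓝[U] s₀) (𝓝 (t - s₀).toNNReal) :=
    ((continuous_real_toNNReal.comp (continuous_const.sub continuous_id)).tendsto s₀).mono_left nhdsWithin_le_nhds
  have hbd : ∀ᶠ s in 𝓝[U] s₀, (t - s).toNNReal ≤ (t - s₀ + 1).toNNReal := by
    filter_upwards [mem_nhdsWithin_of_mem_nhds (Ioi_mem_nhds (show s₀ - 1 < s₀ by linarith))] with s hs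
    exact Real.toNNReal_le_toNNReal (by linarith [mem_Ioi.1 hs])
  exact T.tendsto_app_apply hτ hbd (hw s₀ hs₀)

variable [NormedSpace ℝ E] [IsScalarTower ℝ 𝕜 E] [CompleteSpace E]

/-- **Classical solutions are mild solutions (variation of constants formula).** Let `u : ℝ → E` be
continuous on `[0, t]`, with `u(s) ∈ D(A)` and derivative `u′(s) = Au(s) + g(s)` at every
`s ∈ (0, t)`, where `g` is continuous on `[0, t]`. Then
`u(t) = T(t)u(0) + ∫₀ᵗ T(t − s)g(s) ds`. [cite: EngelNagel2000, Ch. VI Cor. 7.8] -/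
theorem eq_app_add_integral_of_hasDerivAt (T : C0Semigroup 𝕜 E) {u g : ℝ → E} {t : ℝ} (ht : 0 ≤ t)
    (hu : ContinuousOn u (Icc 0 t)) (hg : ContinuousOn g (Icc 0 t))
    (hdom : ∀ s ∈ Ioo 0 t, u s ∈ T.generator.domain)
    (hderiv : ∀ (s : ℝ) (hs : s ∈ Ioo 0 t), HasDerivAt u (T.generator ⟨u s, hdom s hs⟩ + g s) s) :
    u t = T.app t.toNNReal (u 0) + ∫ s in (0 : ℝ)..t, T.app (t - s).toNNReal (g s) := by
  set ψ : ℝ → E := fun s => T.app (t - s).toNNReal (u s) with hψ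
  have hcont : ContinuousOn ψ (Icc 0 t) := T.continuousOn_app_sub_apply t hu
  have hder : ∀ s ∈ Ioo 0 t, HasDerivAt ψ (T.app (t - s).toNNReal (g s)) s := by
    intro s hs
    have hprod := (T.hasDerivWithinAt_app_sub_apply hs.2 (U := Set.univ) (hderiv s hs).hasDerivWithinAt
      (hdom s hs)).hasDerivAt Filter.univ_mem
    refine hprod.congr_deriv ?_
    rw [map_add]
    abel
  have hint : IntervalIntegrable (fun s => T.app (t - s).toNNReal (g s)) volume 0 t :=
    (T.continuousOn_app_sub_apply t hg).intervalIntegrable_of_Icc ht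
  have hftc := intervalIntegral.integral_eq_sub_of_hasDerivAt_of_le ht hcont hder hint
  have hψt : ψ t = u t := by simp only [hψ, sub_self, Real.toNNReal_zero, app_zero, one_apply_eq_self]
  have hψ0 : ψ 0 = T.app t.toNNReal (u 0) := by simp only [hψ, sub_zero]
  rw [hftc, hψt, hψ0]
  abel

/-- **Uniqueness for the homogeneous abstract Cauchy problem** (Engel–Nagel II Thm. 6.7): a function
`u` continuous on `[0, t]`, with `u(s) ∈ D(A)` and `u′(s) = Au(s)` on `(0, t)`, satisfies
`u(t) = T(t)u(0)`. Together with the tree's `hasDerivAt_app_of_mem` (orbits of `D(A)` are classical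
solutions) this is well-posedness of `u′ = Au`, `u(0) = x ∈ D(A)`. [cite: EngelNagel2000, Ch. II Thm. 6.7] -/
theorem eq_app_of_hasDerivAt (T : C0Semigroup 𝕜 E) {u : ℝ → E} {t : ℝ} (ht : 0 ≤ t)
    (hu : ContinuousOn u (Icc 0 t)) (hdom : ∀ s ∈ Ioo 0 t, u s ∈ T.generator.domain)
    (hderiv : ∀ (s : ℝ) (hs : s ∈ Ioo 0 t), HasDerivAt u (T.generator ⟨u s, hdom s hs⟩) s) :
    u t = T.app t.toNNReal (u 0) := by
  have h := T.eq_app_add_integral_of_hasDerivAt (g := fun _ => 0) ht hu continuousOn_const hdom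
    (fun s hs => by rw [add_zero]; exact hderiv s hs)
  simpa using h

/-- The same on the whole half-line: a classical solution of `u′ = Au` on `(0, ∞)`, continuous on
`[0, ∞)`, is the semigroup orbit `u(t) = T(t)u(0)` for every `t ≥ 0`. [cite: EngelNagel2000, Ch. II Thm. 6.7] -/
theorem eq_app_of_hasDerivAt_Ioi (T : C0Semigroup 𝕜 E) {u : ℝ → E} (hu : ContinuousOn u (Ici 0))
    (hdom : ∀ s : ℝ, 0 < s → u s ∈ T.generator.domain)
    (hderiv : ∀ (s : ℝ) (hs : 0 < s), HasDerivAt u (T.generator ⟨u s, hdom s hs⟩) s) (t : ℝ≥0) :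
    u t = T.app t (u 0) := by
  have h := T.eq_app_of_hasDerivAt (t := (t : ℝ)) t.coe_nonneg (hu.mono Icc_subset_Ici_self)
    (fun s hs => hdom s hs.1) (fun s hs => hderiv s hs.1)
  rwa [Real.toNNReal_coe] at h

end C0Semigroup

end Literature.Analysis.UnboundedOperators
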